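import Summits.CriticalPhenomena.CardyFormulaZ2.Theorems.CardySelfRefinementCriticalPathRSWStubFiniteSizeCriteriaMeasure
import Summits.CriticalPhenomena.CardyFormulaZ2.Theorems.CardySelfRefinementCriticalPathRSWStubFiniteSizeCriteriaDual

/-!
# Stub `stub_finiteSizeCriteria` of line finite-size-envelope (crux `CriticalPathRSW`)

Support file for item `stmt-CriticalPhenomena-10267` (route `CardySelfRefinement`, crux
`CriticalPathRSW`, line finite-size-envelope, stub `stub_finiteSizeCriteria`): the finite-size
criteria (H. Kesten, *Percolation theory for mathematicians* (1982), Ch. 5, Thm. 5.1; G. Grimmett,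
*Percolation* (1999), §11.7) for the `k`-dependent self-refinement laws `M_k(ρ, c)` and their duals.

**Statement** (registered stub, namespace
`Summit.CriticalPhenomena.CardyFormulaZ2.Cruxes.CriticalPathRSW.FiniteSizeEnvelope`): for `k = 2, 3`
there are `ε₁ > 0` (`= 1/70756`) and `n₁` (`= 7`) such that for every `ε ∈ (0, ε₁]`, every
parameter point `(ρ, c)` and all `n, m ≥ n₁`, a subcritical certificate
`M_k(ρ,c)(𝓒(kn, 3kn)) < ε` (easy-way crossing of `[-kn, kn] × [-3kn, 3kn]`) excludes a
supercritical certificate at scale `m`: `M_k(ρ,c)(𝓒(3km, km)) ≤ 1 - ε`.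

**Proof.** For `m ≥ n` (`real_hard_le_of_easy_lt`): Kesten's finite-size criterion for `M_k` —
the annulus event `A(0; kn, 4kn)` has probability `< 4ε` (four easy-way rectangles, `kℤ²` and
transposition symmetry), the renormalisation `u(6N) ≤ 17689 u(N)²` (finite-range independence)
keeps `u ≤ 4ε` at all scales `6ʲ kn`, and the hard-way crossing at scale `m` is covered by `≤ 7`
annulus events of the scale just below `km`, so it has probability `≤ 28 ε ≤ 1 - ε`.  For `m < n`
(`real_hard_le_of_easy_lt_dual`): if the hard-way crossing had probability `> 1 - ε`, its failure —
a dual easy-way crossing — would have probability `< ε`; the same criterion for the dual law, run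
from scale `m`, bounds the failure of the easy-way crossing at scale `n` (a dual long crossing) by
`20 ε`, contradicting `ε ≤ 1/21`.
-/

noncomputable section

namespace Summit.CriticalPhenomena.CardyFormulaZ2.Cruxes.CriticalPathRSW.FiniteSizeEnvelope

open Set
open Literature.Probability.LatticeModels Literature.Probability.Percolation

namespace FSC

/-! ### Rectangles and crossing events (local notations)

To keep these support files free of new definitions, the four events of the argument are local
notations for explicit instances of the tree's `openCrossing S A B`:

* `rect[a, b, lo, hi]` — the lattice rectangle `[a, b] × [lo, hi] ∩ ℤ²` (a `Finset`, Mathlib's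
  order interval of `Site 2 = Fin 2 → ℤ`);
* `hCross[a, b, lo, hi]` — its **horizontal open crossing**: an open path inside the rectangle from
  the left side `{x₀ = a}` to the right side `{x₀ = b}`;
* `vCross[a, b, lo, hi]` — its **vertical open crossing**, from `{x₁ = lo}` to `{x₁ = hi}`;
* `annulusCross[c, N, R]` — the **annulus event** `A(c; N, R)` of Kesten (1982), Ch. 5: an open
  path inside the box `c + [-R, R]²` from the box `c + [-N, N]²` to the boundary of `c + [-R, R]²`. -/

local notation3 "rect[" a ", " b ", " lo ", " hi "]" =>
  (Finset.Icc ![(a : ℤ), (lo : ℤ)] ![(b : ℤ), (hi : ℤ)] : Finset (Site 2))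

local notation3 "hCross[" a ", " b ", " lo ", " hi "]" =>
  (openCrossing (↑(Finset.Icc ![(a : ℤ), (lo : ℤ)] ![(b : ℤ), (hi : ℤ)] : Finset (Site 2)) : Set (Site 2))
    {x : Site 2 | x ∈ (Finset.Icc ![(a : ℤ), (lo : ℤ)] ![(b : ℤ), (hi : ℤ)] : Finset (Site 2)) ∧ x 0 = (a : ℤ)}
    {x : Site 2 | x ∈ (Finset.Icc ![(a : ℤ), (lo : ℤ)] ![(b : ℤ), (hi : ℤ)] : Finset (Site 2)) ∧ x 0 = (b : ℤ)} :
    Set (BondConfig (Site 2)))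

local notation3 "vCross[" a ", " b ", " lo ", " hi "]" =>
  (openCrossing (↑(Finset.Icc ![(a : ℤ), (lo : ℤ)] ![(b : ℤ), (hi : ℤ)] : Finset (Site 2)) : Set (Site 2))
    {x : Site 2 | x ∈ (Finset.Icc ![(a : ℤ), (lo : ℤ)] ![(b : ℤ), (hi : ℤ)] : Finset (Site 2)) ∧ x 1 = (lo : ℤ)}
    {x : Site 2 | x ∈ (Finset.Icc ![(a : ℤ), (lo : ℤ)] ![(b : ℤ), (hi : ℤ)] : Finset (Site 2)) ∧ x 1 = (hi : ℤ)} :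
    Set (BondConfig (Site 2)))

local notation3 "annulusCross[" c ", " N ", " R "]" =>
  (openCrossing
    (↑(Finset.Icc ![(c : Site 2) 0 - ((R : ℕ) : ℤ), (c : Site 2) 1 - ((R : ℕ) : ℤ)]
        ![(c : Site 2) 0 + ((R : ℕ) : ℤ), (c : Site 2) 1 + ((R : ℕ) : ℤ)] : Finset (Site 2)) : Set (Site 2))
    (↑(Finset.Icc ![(c : Site 2) 0 - ((N : ℕ) : ℤ), (c : Site 2) 1 - ((N : ℕ) : ℤ)]
        ![(c : Site 2) 0 + ((N : ℕ) : ℤ), (c : Site 2) 1 + ((N : ℕ) : ℤ)] : Finset (Site 2)) : Set (Site 2))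
    {x : Site 2 | x ∈ (Finset.Icc ![(c : Site 2) 0 - ((R : ℕ) : ℤ), (c : Site 2) 1 - ((R : ℕ) : ℤ)]
        ![(c : Site 2) 0 + ((R : ℕ) : ℤ), (c : Site 2) 1 + ((R : ℕ) : ℤ)] : Finset (Site 2)) ∧
      (x 0 = (c : Site 2) 0 - ((R : ℕ) : ℤ) ∨ x 0 = (c : Site 2) 0 + ((R : ℕ) : ℤ) ∨
        x 1 = (c : Site 2) 1 - ((R : ℕ) : ℤ) ∨ x 1 = (c : Site 2) 1 + ((R : ℕ) : ℤ))} :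
    Set (BondConfig (Site 2)))

/-! ## Assembly: the finite-size criteria for `M_k` -/

section Assembly

open MeasureTheory

/-- **The primal criterion** (Kesten 1982, Thm. 5.1, for `M_k(ρ, c)`): if the easy-way crossing of
`[-kn, kn] × [-3kn, 3kn]` has probability `< ε ≤ 1/70756`, then for every `m ≥ n ≥ 1` the hard-way
crossing of `[-3km, 3km] × [-km, km]` has probability `≤ 28 ε`. -/
theorem real_hard_le_of_easy_lt {k : ℕ} (hk : 0 < k) (ρ c : ℝ) {ε : ℝ} (hε : ε ≤ 1 / 70756)
    {n m : ℕ} (hn : 1 ≤ n) (hnm : n ≤ m)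
    (heasy : (selfRefinementMeasure k ρ c).real (KST2023.crossing (k * n) (3 * (k * n))) < ε) :
    (selfRefinementMeasure k ρ c).real (KST2023.crossing (3 * (k * m)) (k * m)) ≤ 28 * ε := by
  set μ := selfRefinementMeasure k ρ c with hμ
  have hkne : k ≠ 0 := hk.ne'
  have hlat : ∀ᵐ ω ∂μ, ω ⊆ (zdGraph 2).edgeSet := selfRefinementMeasure_ae_subset_edgeSet k ρ c
  have hshift : ∀ (t : Site 2) (A : Set (BondConfig (Site 2))),
      μ.real (BondConfig.relabel (sym2Equiv (Site.shift ((k : ℤ) • t))) ⁻¹' A) = μ.real A :=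
    fun t A => selfRefinementMeasure_real_preimage_relabel_shift hkne ρ c t A
  have htrans : ∀ A : Set (BondConfig (Site 2)),
      μ.real (BondConfig.relabel (sym2Equiv (transposeIso.toEquiv : Site 2 ≃ Site 2)) ⁻¹' A) =
        μ.real A :=
    fun A => selfRefinementMeasure_real_preimage_relabel_transpose k ρ c A
  have hindep : ∀ (U V : Finset (Site 2)),
      (∀ u ∈ U, ∀ v ∈ V, (k : ℤ) < |u 0 - v 0| ∨ (k : ℤ) < |u 1 - v 1|) →
      ∀ (A B : Set (BondConfig (Site 2))), DeterminedBy A ↑U.sym2 → DeterminedBy B ↑V.sym2 →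
        MeasurableSet A → MeasurableSet B → μ.real (A ∩ B) ≤ μ.real A * μ.real B :=
    fun U V hUV A B hA hB hAm hBm =>
      (selfRefinementMeasure_real_inter_eq hk ρ c U V hUV A B hA hB hAm hBm).le
  set N := k * n with hN
  set M := k * m with hM
  have hNpos : 0 < N := Nat.mul_pos hk hn
  have hkN : k ≤ N := hN ▸ Nat.le_mul_of_pos_right k hn
  have hNM : N ≤ M := Nat.mul_le_mul_left k hnm
  -- the initial estimate `u₀ < 4ε`
  have hu0 : μ.real (annulusCross[0, N, (4 * N)]) < 4 * ε := by
    have h1 : μ.real (annulusCross[0, N, (4 * N)]) ≤ μ.real (annulusCross[0, N, (3 * N)]) :=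
      real_mono_of_lattice μ hlat fun ω hω h => annulusCross_anti hω (by omega) (by omega) h
    have h2 : μ.real (annulusCross[0, N, (3 * N)]) ≤
        4 * μ.real (hCross[(-(N : ℤ)), (N : ℤ), (-((3 * N : ℕ) : ℤ)), ((3 * N : ℕ) : ℤ)]) := by
      refine real_annulusCross_le_four_mul μ k hlat hshift htrans (by omega : N < 3 * N)
        ![2 * (n : ℤ), 0] ![-(2 * (n : ℤ)), 0] ?_ ?_ ?_ ?_ ?_ ?_ ?_ ?_ ?_ <;>
        simp only [Matrix.cons_val_zero, Matrix.cons_val_one, hN] <;> push_cast <;> linarith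
    rw [← crossing_eq_hCross] at h2
    linarith
  have h0 : 17689 * μ.real (annulusCross[0, N, (4 * N)]) ≤ 1 := by linarith
  have hiter : ∀ j : ℕ, μ.real (annulusCross[0, (6 ^ j * N), (4 * (6 ^ j * N))]) ≤
      μ.real (annulusCross[0, N, (4 * N)]) := fun j =>
    real_annulusCross_iter μ k k hlat hshift hindep hNpos (n' := n) hN (by omega) h0 j
  -- the scale just below `M`
  obtain ⟨j, hj1, hj2⟩ := exists_scale N M hNpos hNM
  have hNj : 0 < 6 ^ j * N := by positivity
  have hj2' : M < 6 * (6 ^ j * N) := by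
    have e : 6 ^ (j + 1) * N = 6 * (6 ^ j * N) := by ring
    omega
  have hcov := real_hCross_le_card_mul μ k hlat hshift (a := -((3 * M : ℕ) : ℤ)) (b := ((3 * M : ℕ) : ℤ))
    (lo := -(M : ℤ)) (hi := (M : ℤ)) hNj (by omega : 6 ^ j * N ≤ 4 * (6 ^ j * N))
    (n' := 6 ^ j * n) (by rw [hN]; ring) (-(3 * (m : ℤ)))
    (by
      have e : (-((3 * M : ℕ) : ℤ)) - (k : ℤ) * (-(3 * (m : ℤ))) = 0 := by
        rw [hM]; push_cast; ring
      rw [e, abs_zero]; positivity)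
    (by
      have e1 : ((6 ^ j * N : ℕ) : ℤ) ≤ M := by exact_mod_cast hj1
      rw [hM] at e1 ⊢; push_cast at e1 ⊢; linarith)
  rw [← crossing_eq_hCross] at hcov
  have hcard : ((Finset.Icc ((-(M : ℤ) + ((6 ^ j * N : ℕ) : ℤ)) / (2 * ((6 ^ j * N : ℕ) : ℤ)))
      (((M : ℤ) + ((6 ^ j * N : ℕ) : ℤ)) / (2 * ((6 ^ j * N : ℕ) : ℤ)))).card : ℝ) ≤ ((3 + 1 - (-3) : ℤ).toNat : ℕ) := by
    refine card_Icc_grid_le hNj ?_ ?_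
    · have e1 : ((M : ℕ) : ℤ) < 6 * ((6 ^ j * N : ℕ) : ℤ) := by exact_mod_cast hj2'
      linarith
    · have e1 : ((M : ℕ) : ℤ) < 6 * ((6 ^ j * N : ℕ) : ℤ) := by exact_mod_cast hj2'
      linarith
  have hseven : ((3 + 1 - (-3) : ℤ).toNat : ℕ) = 7 := by decide
  rw [hseven] at hcard
  have huj := hiter j
  have hnonneg : 0 ≤ μ.real (annulusCross[0, (6 ^ j * N), (4 * (6 ^ j * N))]) := measureReal_nonneg
  calc μ.real (KST2023.crossing (3 * M) M)
      ≤ _ := hcov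
    _ ≤ 7 * μ.real (annulusCross[0, (6 ^ j * N), (4 * (6 ^ j * N))]) := by
        push_cast at hcard
        exact mul_le_mul_of_nonneg_right hcard hnonneg
    _ ≤ 28 * ε := by linarith

/-- **The dual criterion** (Kesten 1982, Thm. 5.1, for the dual of `M_k(ρ, c)`): if the easy-way
crossing at scale `n` has probability `< ε ≤ 1/70756` then at every scale `7 ≤ m ≤ n` the hard-way
crossing has probability `≤ 1 - ε` (otherwise its failure, a dual easy-way crossing, has
probability `< ε`, the dual criterion runs from scale `m`, and the failure of the easy-way crossing
at scale `n`, a dual hard-way crossing, gets probability `< 20ε`, contradicting `ε ≤ 1/21`). -/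
theorem real_hard_le_of_easy_lt_dual {k : ℕ} (hk : 0 < k) (ρ c : ℝ) {ε : ℝ} (hε0 : 0 < ε)
    (hε : ε ≤ 1 / 70756) {n m : ℕ} (hm : 7 ≤ m) (hmn : m ≤ n)
    (heasy : (selfRefinementMeasure k ρ c).real (KST2023.crossing (k * n) (3 * (k * n))) < ε) :
    (selfRefinementMeasure k ρ c).real (KST2023.crossing (3 * (k * m)) (k * m)) ≤ 1 - ε := by
  by_contra hcon
  rw [not_le] at hcon
  set μ := selfRefinementMeasure k ρ c with hμ
  have hkne : k ≠ 0 := hk.ne'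
  haveI : IsProbabilityMeasure ((selfRefinementMeasure k ρ c).map dualConfig) :=
    isProbabilityMeasure_dual k ρ c
  -- the primal shift invariance and the hypotheses of the dual law
  have hshiftP : ∀ (t : Site 2) (A : Set (BondConfig (Site 2))),
      μ.real (BondConfig.relabel (sym2Equiv (Site.shift ((k : ℤ) • t))) ⁻¹' A) = μ.real A :=
    fun t A => selfRefinementMeasure_real_preimage_relabel_shift hkne ρ c t A
  have hlat : ∀ᵐ ω ∂((selfRefinementMeasure k ρ c).map dualConfig), ω ⊆ (zdGraph 2).edgeSet :=
    dual_ae_subset_edgeSet k ρ c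
  have hshift : ∀ (t : Site 2) (A : Set (BondConfig (Site 2))),
      ((selfRefinementMeasure k ρ c).map dualConfig).real
          (BondConfig.relabel (sym2Equiv (Site.shift ((k : ℤ) • t))) ⁻¹' A) =
        ((selfRefinementMeasure k ρ c).map dualConfig).real A :=
    fun t A => dual_real_preimage_shift hkne ρ c t A
  have htrans : ∀ A : Set (BondConfig (Site 2)),
      ((selfRefinementMeasure k ρ c).map dualConfig).real
          (BondConfig.relabel (sym2Equiv (transposeIso.toEquiv : Site 2 ≃ Site 2)) ⁻¹' A) =
        ((selfRefinementMeasure k ρ c).map dualConfig).real A :=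
    fun A => dual_real_preimage_transpose k ρ c A
  have hindep : ∀ (U V : Finset (Site 2)),
      (∀ u ∈ U, ∀ v ∈ V, ((k + 1 : ℕ) : ℤ) < |u 0 - v 0| ∨ ((k + 1 : ℕ) : ℤ) < |u 1 - v 1|) →
      ∀ (A B : Set (BondConfig (Site 2))), DeterminedBy A ↑U.sym2 → DeterminedBy B ↑V.sym2 →
        MeasurableSet A → MeasurableSet B →
          ((selfRefinementMeasure k ρ c).map dualConfig).real (A ∩ B) ≤
            ((selfRefinementMeasure k ρ c).map dualConfig).real A *
              ((selfRefinementMeasure k ρ c).map dualConfig).real B :=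
    fun U V hUV A B hA hB hAm hBm => (dual_real_inter_eq hk ρ c U V hUV A B hA hB hAm hBm).le
  obtain ⟨m₂, rfl⟩ : ∃ m₂, m = m₂ + 2 := ⟨m - 2, by omega⟩
  set N := k * n with hN
  set M := k * (m₂ + 2) with hM
  have hNpos : 0 < N := Nat.mul_pos hk (by omega)
  -- Step 1: the failure of the hard-way crossing is a dual easy-way crossing of probability `< ε`
  have hhard_meas : MeasurableSet (KST2023.crossing (3 * M) M) := by
    rw [crossing_eq_hCross]; exact measurableSet_hCross _ _ _ _
  have hc1 : μ.real (KST2023.crossing (3 * M) M)ᶜ < ε := by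
    rw [probReal_compl_eq_one_sub hhard_meas]; linarith
  have hc2 : μ.real (hCross[0, ((6 * M : ℕ) : ℤ), 0, ((2 * M : ℕ) : ℤ)])ᶜ = μ.real (KST2023.crossing (3 * M) M)ᶜ := by
    have key : μ.real (hCross[0, ((6 * M : ℕ) : ℤ), 0, ((2 * M : ℕ) : ℤ)]) =
        μ.real (hCross[(-((3 * M : ℕ) : ℤ)), ((3 * M : ℕ) : ℤ), (-(M : ℤ)), (M : ℤ)]) := by
      refine real_hCross_shift_eq μ k hshiftP ![3 * ((m₂ : ℤ) + 2), (m₂ : ℤ) + 2] ?_ ?_ ?_ ?_ <;>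
        simp only [Matrix.cons_val_zero, Matrix.cons_val_one, hM] <;> push_cast <;> ring
    rw [probReal_compl_eq_one_sub (measurableSet_hCross _ _ _ _), probReal_compl_eq_one_sub hhard_meas,
      crossing_eq_hCross, key]
  have hc3 : ((selfRefinementMeasure k ρ c).map dualConfig).real
      (vCross[0, (((6 * M : ℕ) : ℤ) - 1), (-1), ((2 * M : ℕ) : ℤ)]) ≤
      μ.real (hCross[0, ((6 * M : ℕ) : ℤ), 0, ((2 * M : ℕ) : ℤ)])ᶜ :=
    real_dual_le_compl_hCross k ρ c (6 * M) (2 * M)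
  have hc4 : ((selfRefinementMeasure k ρ c).map dualConfig).real
      (vCross[0, (((6 * M : ℕ) : ℤ) - 1), (-1), ((2 * M : ℕ) : ℤ)]) =
      ((selfRefinementMeasure k ρ c).map dualConfig).real
        (hCross[(-1), ((2 * M : ℕ) : ℤ), 0, (((6 * M : ℕ) : ℤ) - 1)]) := by
    rw [← preimage_transpose_hCross, htrans]
  have hεd : ((selfRefinementMeasure k ρ c).map dualConfig).real
      (hCross[(-1), ((2 * M : ℕ) : ℤ), 0, (((6 * M : ℕ) : ℤ) - 1)]) < ε := by
    rw [← hc4]; linarith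
  -- Step 2: the dual criterion from scale `m`
  have hN'pos : 0 < k * m₂ := Nat.mul_pos hk (by omega)
  have hkN' : k ≤ k * m₂ := Nat.le_mul_of_pos_right k (by omega)
  have h4 : ((selfRefinementMeasure k ρ c).map dualConfig).real (annulusCross[0, (k * m₂), (k * (3 * m₂ + 5))]) ≤
      4 * ((selfRefinementMeasure k ρ c).map dualConfig).real
        (hCross[(-1), ((2 * M : ℕ) : ℤ), 0, (((6 * M : ℕ) : ℤ) - 1)]) := by
    have hk1 : (1 : ℤ) ≤ k := by exact_mod_cast hk
    refine real_annulusCross_le_four_mul _ k hlat hshift htrans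
      ((Nat.mul_lt_mul_left hk).2 (by omega) : k * m₂ < k * (3 * m₂ + 5))
      ![(m₂ : ℤ) + 1, -(3 * (m₂ : ℤ) + 5)] ![-(3 * (m₂ : ℤ) + 4), -(3 * (m₂ : ℤ) + 5)]
      ?_ ?_ ?_ ?_ ?_ ?_ ?_ ?_ ?_ <;>
      simp only [Matrix.cons_val_zero, Matrix.cons_val_one, hM] <;> push_cast <;> linarith
  have hu0 : ((selfRefinementMeasure k ρ c).map dualConfig).real (annulusCross[0, (k * m₂), (4 * (k * m₂))]) < 4 * ε := by
    have h1 : ((selfRefinementMeasure k ρ c).map dualConfig).real (annulusCross[0, (k * m₂), (4 * (k * m₂))]) ≤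
        ((selfRefinementMeasure k ρ c).map dualConfig).real (annulusCross[0, (k * m₂), (k * (3 * m₂ + 5))]) :=
      real_mono_of_lattice _ hlat fun ω hω h => annulusCross_anti hω (Nat.mul_le_mul_left k (by omega))
        (by rw [show 4 * (k * m₂) = k * (4 * m₂) by ring]; exact Nat.mul_le_mul_left k (by omega)) h
    linarith
  have h0 : 17689 * ((selfRefinementMeasure k ρ c).map dualConfig).real (annulusCross[0, (k * m₂), (4 * (k * m₂))]) ≤ 1 := by
    linarith
  have hiter : ∀ j : ℕ, ((selfRefinementMeasure k ρ c).map dualConfig).real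
      (annulusCross[0, (6 ^ j * (k * m₂)), (4 * (6 ^ j * (k * m₂)))]) ≤
      ((selfRefinementMeasure k ρ c).map dualConfig).real (annulusCross[0, (k * m₂), (4 * (k * m₂))]) := fun j =>
    real_annulusCross_iter _ k (k + 1) hlat hshift hindep hN'pos (n' := m₂) rfl (by omega) h0 j
  -- Step 3: the failure of the easy-way crossing at scale `n` is a dual hard-way crossing
  have heasy_meas : MeasurableSet (KST2023.crossing N (3 * N)) := by
    rw [crossing_eq_hCross]; exact measurableSet_hCross _ _ _ _
  have he1 : μ.real (hCross[0, ((2 * N : ℕ) : ℤ), 0, ((6 * N : ℕ) : ℤ)])ᶜ = μ.real (KST2023.crossing N (3 * N))ᶜ := by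
    have key : μ.real (hCross[0, ((2 * N : ℕ) : ℤ), 0, ((6 * N : ℕ) : ℤ)]) =
        μ.real (hCross[(-(N : ℤ)), (N : ℤ), (-((3 * N : ℕ) : ℤ)), ((3 * N : ℕ) : ℤ)]) := by
      refine real_hCross_shift_eq μ k hshiftP ![(n : ℤ), 3 * (n : ℤ)] ?_ ?_ ?_ ?_ <;>
        simp only [Matrix.cons_val_zero, Matrix.cons_val_one, hN] <;> push_cast <;> ring
    rw [probReal_compl_eq_one_sub (measurableSet_hCross _ _ _ _), probReal_compl_eq_one_sub heasy_meas,
      crossing_eq_hCross, key]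
  have he2 : μ.real (hCross[0, ((2 * N : ℕ) : ℤ), 0, ((6 * N : ℕ) : ℤ)])ᶜ ≤
      ((selfRefinementMeasure k ρ c).map dualConfig).real
        (vCross[0, (((2 * N : ℕ) : ℤ) - 1), (-1), ((6 * N : ℕ) : ℤ)]) :=
    real_compl_hCross_le_dual k ρ c (2 * N) (6 * N)
  have he3 : ((selfRefinementMeasure k ρ c).map dualConfig).real
      (vCross[0, (((2 * N : ℕ) : ℤ) - 1), (-1), ((6 * N : ℕ) : ℤ)]) =
      ((selfRefinementMeasure k ρ c).map dualConfig).real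
        (hCross[(-1), ((6 * N : ℕ) : ℤ), 0, (((2 * N : ℕ) : ℤ) - 1)]) := by
    rw [← preimage_transpose_hCross, htrans]
  -- the dual scale just below `6N / 4`
  obtain ⟨j, hj1, hj2⟩ := exists_scale (4 * (k * m₂)) (6 * N) (by omega)
    (by rw [hN]; exact Nat.mul_le_mul (by norm_num) (Nat.mul_le_mul_left k (by omega)))
  have hNj : 0 < 6 ^ j * (k * m₂) := by positivity
  have hj1' : 4 * (6 ^ j * (k * m₂)) ≤ 6 * N := by
    have e : 6 ^ j * (4 * (k * m₂)) = 4 * (6 ^ j * (k * m₂)) := by ring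
    omega
  have hj2' : 6 * N < 24 * (6 ^ j * (k * m₂)) := by
    have e : 6 ^ (j + 1) * (4 * (k * m₂)) = 24 * (6 ^ j * (k * m₂)) := by ring
    omega
  have hcov := real_hCross_le_card_mul ((selfRefinementMeasure k ρ c).map dualConfig) k hlat hshift
    (a := -1) (b := ((6 * N : ℕ) : ℤ)) (lo := 0) (hi := ((2 * N : ℕ) : ℤ) - 1) hNj
    (by omega : 6 ^ j * (k * m₂) ≤ 4 * (6 ^ j * (k * m₂))) (n' := 6 ^ j * m₂) (by ring) 0
    (by
      rw [mul_zero, sub_zero]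
      have e1 : (1 : ℤ) ≤ ((6 ^ j * (k * m₂) : ℕ) : ℤ) := by exact_mod_cast hNj
      simpa using e1)
    (by
      have e1 : ((4 * (6 ^ j * (k * m₂)) : ℕ) : ℤ) ≤ ((6 * N : ℕ) : ℤ) := by exact_mod_cast hj1'
      push_cast at e1 ⊢; linarith)
  have hcard : ((Finset.Icc ((0 + ((6 ^ j * (k * m₂) : ℕ) : ℤ)) / (2 * ((6 ^ j * (k * m₂) : ℕ) : ℤ)))
      ((((2 * N : ℕ) : ℤ) - 1 + ((6 ^ j * (k * m₂) : ℕ) : ℤ)) / (2 * ((6 ^ j * (k * m₂) : ℕ) : ℤ)))).card : ℝ) ≤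
      ((4 + 1 - 0 : ℤ).toNat : ℕ) := by
    refine card_Icc_grid_le hNj ?_ ?_
    · rw [zero_mul, zero_add]; positivity
    · have e1 : ((6 * N : ℕ) : ℤ) < 24 * ((6 ^ j * (k * m₂) : ℕ) : ℤ) := by exact_mod_cast hj2'
      push_cast at e1 ⊢
      linarith
  have hfive : ((4 + 1 - 0 : ℤ).toNat : ℕ) = 5 := by decide
  rw [hfive] at hcard
  have huj := hiter j
  have hnonneg : 0 ≤ ((selfRefinementMeasure k ρ c).map dualConfig).real
      (annulusCross[0, (6 ^ j * (k * m₂)), (4 * (6 ^ j * (k * m₂)))]) := measureReal_nonneg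
  have hchain : μ.real (KST2023.crossing N (3 * N))ᶜ < 20 * ε := by
    calc μ.real (KST2023.crossing N (3 * N))ᶜ
        = μ.real (hCross[0, ((2 * N : ℕ) : ℤ), 0, ((6 * N : ℕ) : ℤ)])ᶜ := he1.symm
      _ ≤ _ := he2
      _ = _ := he3
      _ ≤ _ := hcov
      _ ≤ 5 * ((selfRefinementMeasure k ρ c).map dualConfig).real
            (annulusCross[0, (6 ^ j * (k * m₂)), (4 * (6 ^ j * (k * m₂)))]) := by
          push_cast at hcard
          exact mul_le_mul_of_nonneg_right hcard hnonneg
      _ < 20 * ε := by linarith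
  rw [probReal_compl_eq_one_sub heasy_meas] at hchain
  linarith

end Assembly

end FSC

open FSC in
/-- **STUB `stub_finiteSizeCriteria`** of line finite-size-envelope (crux `CriticalPathRSW`): the
finite-size criteria for the `k`-dependent planar laws `M_k(ρ, c)`, `k = 2, 3` (primal and dual,
jointly).  With `ε₁ = 1/70756` and `n₁ = 7`: for every `ε ∈ (0, ε₁]`, every parameter point and
all scales `n, m ≥ 7`, a subcritical certificate `M_k(ρ,c)(easy k n) < ε` (easy-way crossing of
`[-kn, kn] × [-3kn, 3kn]`) excludes a supercritical certificate at scale `m`: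
`M_k(ρ,c)(hard k m) ≤ 1 - ε` (hard-way crossing of `[-3km, 3km] × [-km, km]`).  For `m ≥ n` this is
Kesten's finite-size criterion (annulus events `A(N; 4N)`, initial bound by four easy-way
rectangles, renormalisation `u(6N) ≤ 17689 u(N)²` by finite-range independence, covering of the
hard-way crossing by `≤ 7` annulus events); for `m < n` the same criterion for the law of the dual
configuration, entered and left through planar duality. -/
theorem stub_finiteSizeCriteria :
  ∀ k : ℕ, k = 2 ∨ k = 3 → ∃ ε₁ > 0, ∃ n₁ : ℕ, 1 ≤ n₁ ∧
    ∀ ε : ℝ, 0 < ε → ε ≤ ε₁ → ∀ (ρ c : ℝ) (n m : ℕ), n₁ ≤ n → n₁ ≤ m →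
      (selfRefinementMeasure k ρ c).real (KST2023.crossing (k * n) (3 * (k * n))) < ε →
        (selfRefinementMeasure k ρ c).real (KST2023.crossing (3 * (k * m)) (k * m)) ≤ 1 - ε := by
  intro k hk
  have hkpos : 0 < k := by rcases hk with rfl | rfl <;> norm_num
  refine ⟨1 / 70756, by norm_num, 7, by norm_num, ?_⟩
  intro ε hε0 hε1 ρ c n m hn hm heasy
  rcases le_or_gt n m with hnm | hmn
  · have h := FSC.real_hard_le_of_easy_lt hkpos ρ c hε1 (by omega) hnm heasy
    linarith
  · exact FSC.real_hard_le_of_easy_lt_dual hkpos ρ c hε0 hε1 hm hmn.le heasy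

end Summit.CriticalPhenomena.CardyFormulaZ2.Cruxes.CriticalPathRSW.FiniteSizeEnvelope
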